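import Literature.NumberTheory.Sieve.RoughNumbersBuchstabStep
import Literature.NumberTheory.LFunctions.MidpointSieveGain
import Mathlib.Analysis.Complex.ExponentialBounds
import HarnessLib

/-!
# Rough numbers and Buchstab's function: `Φ(x, y) = (x ω(u) − y)/log y + O(x/log² y)`

Topic `Literature/NumberTheory/Sieve`. Everything here is PROVED (no definitions, no named facts).
With `Φ(x, y) = #{1 ≤ n ≤ x : p ∣ n ⇒ p ≥ y} = #roughIcc ⌈y⌉₊ ⌊x⌋₊`, `u = log x/log y` and Buchstab's
function `ω` (`BuchstabFunction.lean`):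

* `exists_abs_card_roughIcc_sub_main_le` — for every `k ≥ 2` there is `C` with
  `|Φ(x, y) − (x ω(u) − y)/log y| ≤ C x/log² y` for all `2 ≤ y ≤ x ≤ y^k`;
* `exists_abs_card_roughIcc_sub_main_le_of_rpow` — the same for `x ≤ y^U`, `U` real;
* `exists_abs_card_roughIcc_sub_buchstab_le` — **Lichtman's Lemma 6.1** ([WuI]): for `U ≥ 2` there
  is `C` with `|Φ(x, y) − ω(u) x/log y| ≤ C x/log² y` for all `2 ≤ y`, `y² ≤ x ≤ y^U`
  ("Let `x ≥ 2` and `y = x^{1/u}`. Then `∑_{n ≤ x, p ∣ n ⇒ p ≥ y} 1 = ω(u) x/log y + O(x/(log y)²)`";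
  the printed statement is uniform for `u` in compact subsets of `(1, ∞)`, and with the secondary
  term `−y/log y` down to `u = 1`: Tenenbaum, *Introduction to analytic and probabilistic number
  theory*, Ch. III.6, there even uniformly in `u`; here `u ≤ U` — all that Lichtman's and
  Wu's applications use).

Proof: induction on `k` (Harman, *Prime-Detecting Sieves*, Appendix A.2): the base `u ≤ 2`
(`abs_card_roughIcc_sub_main_base`: `Φ(x, y) = 1 + π(x) − π(y⁻) + O(1)` and the prime number
theorem with error `x/log² x`), and the step `RoughNumbersBuchstabStep.lean` (Buchstab's identity
at `z = x^{1/k}`, Abel summation through `ϑ` with the de la Vallée Poussin error term — PROVED in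
the tree — and the integral equation of `ω`). Small `y < e²` are trivial
(`abs_card_roughIcc_sub_main_le_four_mul`). Constants are not optimised.

## References

* J. D. Lichtman, *A modification of the linear sieve, and the count of twin primes*, Algebra &
  Number Theory 19 (2025) 1–38, arXiv:2109.02851, Lemma 6.1. [Lichtman2025LinearSieve]
* G. Harman, *Prime-Detecting Sieves*, LMS Monographs 33 (2007), §1.4 (1.4.14), Appendix A.2.
* G. Tenenbaum, *Introduction to analytic and probabilistic number theory*, Ch. III.6 (the theorem
  `Φ(x, y) = (x ω(u) − y)/log y + O(x/log² y)`).
-/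

open Finset Real MeasureTheory Set
open scoped Chebyshev

noncomputable section

namespace Literature.NumberTheory.Sieve

/-! ### Trivial bounds -/

/-- `Φ(x, y) ≤ x`. [folklore] -/
theorem card_roughIcc_ceil_floor_le {x y : ℝ} (hx : 0 ≤ x) :
    ((roughIcc ⌈y⌉₊ ⌊x⌋₊).card : ℝ) ≤ x := by
  have h : (roughIcc ⌈y⌉₊ ⌊x⌋₊).card ≤ ⌊x⌋₊ :=
    (Finset.card_le_card (roughIcc_subset_Icc _ _)).trans (by simp)
  calc ((roughIcc ⌈y⌉₊ ⌊x⌋₊).card : ℝ) ≤ ⌊x⌋₊ := by exact_mod_cast h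
    _ ≤ x := Nat.floor_le hx

/-- **The trivial bound** `|Φ(x, y) − (x ω(u) − y)/log y| ≤ 4x` for `2 ≤ y ≤ x`
(`0 ≤ Φ ≤ x`, `0 ≤ ω ≤ 1`, `log y ≥ log 2 > 2/3`). [folklore] -/
theorem abs_card_roughIcc_sub_main_le_four_mul {x y : ℝ} (hy : 2 ≤ y) (hyx : y ≤ x) :
    |((roughIcc ⌈y⌉₊ ⌊x⌋₊).card : ℝ) -
        (x * buchstabOmega (Real.log x / Real.log y) - y) / Real.log y| ≤ 4 * x := by
  have hx0 : 0 ≤ x := by linarith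
  have hl2 : (2 : ℝ) / 3 < Real.log 2 := by have := Real.log_two_gt_d9; linarith
  have hly : Real.log 2 ≤ Real.log y := Real.log_le_log two_pos hy
  have hly0 : 0 < Real.log y := by linarith
  have hΦ := card_roughIcc_ceil_floor_le (y := y) hx0
  have hΦ0 : (0 : ℝ) ≤ ((roughIcc ⌈y⌉₊ ⌊x⌋₊).card : ℝ) := Nat.cast_nonneg _
  have hω0 := buchstabOmega_nonneg (Real.log x / Real.log y)
  have hω1 := buchstabOmega_le_one (Real.log x / Real.log y)
  have hM : |(x * buchstabOmega (Real.log x / Real.log y) - y) / Real.log y| ≤ 3 * x := by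
    rw [abs_div, abs_of_pos hly0, div_le_iff₀ hly0]
    have h1 : |x * buchstabOmega (Real.log x / Real.log y) - y| ≤ x + y := by
      rw [abs_le]; constructor <;> nlinarith
    calc |x * buchstabOmega (Real.log x / Real.log y) - y| ≤ x + y := h1
      _ ≤ 2 * x := by linarith
      _ = 3 * x * (2 / 3) := by ring
      _ ≤ 3 * x * Real.log y := by gcongr; linarith
  calc _ ≤ |((roughIcc ⌈y⌉₊ ⌊x⌋₊).card : ℝ)| +
        |(x * buchstabOmega (Real.log x / Real.log y) - y) / Real.log y| := abs_sub _ _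
    _ ≤ x + 3 * x := by rw [abs_of_nonneg hΦ0]; exact add_le_add hΦ hM
    _ = 4 * x := by ring

/-- For `2 ≤ y < e²` (`y ≤ x`): `|Φ(x, y) − (x ω(u) − y)/log y| ≤ 16 x/log² y`. [folklore] -/
theorem abs_card_roughIcc_sub_main_le_of_lt_exp_two {x y : ℝ} (hy : 2 ≤ y) (hyx : y ≤ x)
    (hy2 : y < Real.exp 2) :
    |((roughIcc ⌈y⌉₊ ⌊x⌋₊).card : ℝ) -
        (x * buchstabOmega (Real.log x / Real.log y) - y) / Real.log y| ≤
      16 * x / Real.log y ^ 2 := by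
  have hx0 : 0 ≤ x := by linarith
  have hy0 : 0 < y := by linarith
  have hly0 : 0 < Real.log y := Real.log_pos (by linarith)
  have hly2 : Real.log y < 2 := by rw [Real.log_lt_iff_lt_exp hy0]; exact hy2
  refine (abs_card_roughIcc_sub_main_le_four_mul hy hyx).trans ?_
  rw [le_div_iff₀ (by positivity)]
  have : Real.log y ^ 2 ≤ 4 := by nlinarith
  nlinarith

/-! ### The base case `u ≤ 2` -/

/-- **The base case `1 ≤ u ≤ 2`** of Lichtman's Lemma 6.1: for `2 ≤ y ≤ x ≤ y²` and
`|ϑ(t) − t| ≤ C₀ t/log² t` (`t ≥ 2`),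
`|Φ(x, y) − (x ω(u) − y)/log y| ≤ (16 + 12C₀) x/log² y`.
Here `ω(u) = 1/u`, so the main term is `x/log x − y/log y`, while
`Φ(x, y) = 1 + #{y ≤ p ≤ x} + O(1)` (`card_roughIcc_le_two_add_card_primes`) and
`#{⌈y⌉ − 1 < p ≤ x} = x/log x − a/log a + O(x/log² a)`, `a = ⌈y⌉ − 1`
(`abs_card_primes_Ioc_sub_le`; Harman (A.2.1)). [cite: Lichtman2025LinearSieve, Lemma 6.1] -/
theorem abs_card_roughIcc_sub_main_base {C₀ : ℝ} (hC₀ : 0 ≤ C₀)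
    (hE : ∀ t : ℝ, 2 ≤ t → |θ t - t| ≤ C₀ * t / Real.log t ^ 2) {x y : ℝ} (hy : 2 ≤ y)
    (hyx : y ≤ x) (hxy : Real.log x ≤ 2 * Real.log y) :
    |((roughIcc ⌈y⌉₊ ⌊x⌋₊).card : ℝ) -
        (x * buchstabOmega (Real.log x / Real.log y) - y) / Real.log y| ≤
      (16 + 12 * C₀) * x / Real.log y ^ 2 := by
  have hx0 : 0 < x := by linarith
  rcases lt_or_ge y (Real.exp 2) with hy2 | hy2
  · refine (abs_card_roughIcc_sub_main_le_of_lt_exp_two hy hyx hy2).trans ?_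
    rw [div_le_div_iff_of_pos_right (by have := Real.log_pos (by linarith : (1 : ℝ) < y); positivity)]
    nlinarith
  -- `y ≥ e²`
  have he1 : (2 : ℝ) ≤ Real.exp 1 := by have := Real.add_one_le_exp (1 : ℝ); linarith
  have he2 : Real.exp 1 ≤ Real.exp 2 - 1 := by
    have h2 : Real.exp 2 = Real.exp 1 * Real.exp 1 := by rw [← Real.exp_add]; norm_num
    nlinarith
  have hy0 : 0 < y := by linarith
  have hy3 : 3 ≤ y := le_trans (by have := Real.add_one_le_exp (2 : ℝ); linarith) hy2
  have hy1 : 1 < y := by linarith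
  have hly : 0 < Real.log y := Real.log_pos hy1
  have hlx : Real.log y ≤ Real.log x := Real.log_le_log hy0 hyx
  have hLx : 0 < Real.log x := by linarith
  -- `N = ⌈y⌉`, `X = ⌊x⌋`, `a = N − 1`
  set N := ⌈y⌉₊ with hN
  set X := ⌊x⌋₊ with hX
  have hN1 : 0 < N := Nat.ceil_pos.mpr hy0
  set a : ℝ := ((N - 1 : ℕ) : ℝ) with ha_def
  have haN : a = (N : ℝ) - 1 := by rw [ha_def, Nat.cast_sub hN1, Nat.cast_one]
  have hyN : y ≤ N := Nat.le_ceil y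
  have hNy : (N : ℝ) < y + 1 := Nat.ceil_lt_add_one hy0.le
  have hay : a ≤ y := by rw [haN]; linarith
  have hya : y ≤ a + 1 := by rw [haN]; linarith
  have hea : Real.exp 1 ≤ a := by linarith
  have ha0 : 0 < a := (Real.exp_pos 1).trans_le hea
  have hla : 1 ≤ Real.log a := by rw [Real.le_log_iff_exp_le ha0]; exact hea
  have hlay : Real.log a ≤ Real.log y := Real.log_le_log ha0 hay
  have hax : a ≤ x := hay.trans hyx
  have hasq : y ≤ a ^ 2 := by
    have h1 : y - 1 ≤ a := by linarith
    have h2 : (y - 1) ^ 2 ≤ a ^ 2 := pow_le_pow_left₀ (by linarith) h1 2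
    have h3 : y ≤ (y - 1) ^ 2 := by nlinarith
    exact h3.trans h2
  have hlya : Real.log y ≤ 2 * Real.log a := by
    calc Real.log y ≤ Real.log (a ^ 2) := Real.log_le_log hy0 hasq
      _ = 2 * Real.log a := by rw [Real.log_pow]; norm_num
  -- `1 ≤ X ≤ N²`
  have hX1 : 1 ≤ X := by rw [hX, Nat.one_le_floor_iff]; linarith
  have hx_le : x ≤ (N : ℝ) * N := by
    have h1 : x ≤ y ^ 2 := by
      calc x = Real.exp (Real.log x) := (Real.exp_log hx0).symm
        _ ≤ Real.exp (2 * Real.log y) := Real.exp_le_exp.mpr hxy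
        _ = y ^ 2 := by
            rw [show (2 : ℝ) * Real.log y = Real.log (y ^ 2) by rw [Real.log_pow]; norm_num,
              Real.exp_log (by positivity)]
    nlinarith [mul_le_mul hyN hyN hy0.le (Nat.cast_nonneg N)]
  have hXN : X ≤ N * N := by
    have h := Nat.floor_le_floor hx_le
    rwa [show ((N : ℝ) * N) = ((N * N : ℕ) : ℝ) by push_cast; ring, Nat.floor_natCast] at h
  -- `Φ = 1 + #P + O(1)`
  have hlo := one_add_card_primes_le_card_roughIcc (N := N) hX1
  have hhi := card_roughIcc_le_two_add_card_primes hXN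
  have hfloor_a : ⌊a⌋₊ = N - 1 := by rw [ha_def, Nat.floor_natCast]
  have hPeq : (Finset.Icc N X).filter Nat.Prime = (Finset.Ioc ⌊a⌋₊ ⌊x⌋₊).filter Nat.Prime := by
    rw [hfloor_a]
    congr 1
    ext p
    simp only [Finset.mem_Icc, Finset.mem_Ioc]
    omega
  rw [hPeq] at hlo hhi
  set P := ((Finset.Ioc ⌊a⌋₊ ⌊x⌋₊).filter Nat.Prime).card with hP
  have hlo' : (1 : ℝ) + P ≤ ((roughIcc N X).card : ℝ) := by exact_mod_cast hlo
  have hhi' : ((roughIcc N X).card : ℝ) ≤ 2 + P := by exact_mod_cast hhi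
  -- `#P = x/log x − a/log a + O(x/log² a)`
  have hprimes := Literature.NumberTheory.LFunctions.abs_card_primes_Ioc_sub_le hea hax hC₀ hE
  -- `ω(u) = 1/u`
  have hu1 : 1 ≤ Real.log x / Real.log y := by rw [le_div_iff₀ hly]; linarith
  have hu2 : Real.log x / Real.log y ≤ 2 := by rw [div_le_iff₀ hly]; linarith
  have hmain : (x * buchstabOmega (Real.log x / Real.log y) - y) / Real.log y =
      x / Real.log x - y / Real.log y := by
    rw [buchstabOmega_eq_inv hu1 hu2]
    field_simp
  -- `0 ≤ y/log y − a/log a ≤ 1`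
  have hmono : a / Real.log a ≤ y / Real.log y := by
    have h := Real.log_div_self_antitoneOn hea (hea.trans hay) hay
    -- `h : log y / y ≤ log a / a`
    rw [div_le_div_iff₀ (by linarith) hly]
    have h' := (div_le_div_iff₀ hy0 ha0).mp h
    linarith
  have hdiff : y / Real.log y - a / Real.log a ≤ 1 := by
    have h1 : y / Real.log y ≤ y / Real.log a := div_le_div_of_nonneg_left hy0.le (by linarith) hlay
    have h2 : y / Real.log a - a / Real.log a ≤ 1 := by
      rw [← sub_div, div_le_one (by linarith)]; linarith
    linarith
  -- `log² y ≤ 4x` and `1/log² a ≤ 4/log² y`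
  have hlogsq : Real.log y ^ 2 ≤ 4 * x := by
    -- `log² y ≤ 4y` (`log √y ≤ √y − 1`; also `Literature.NumberTheory.Transcendental.log_sq_le_four_mul`)
    have hs0 : 0 < Real.sqrt y := Real.sqrt_pos.mpr hy0
    have h1 : Real.log (Real.sqrt y) ≤ Real.sqrt y - 1 := Real.log_le_sub_one_of_pos hs0
    have h2 : Real.log y = 2 * Real.log (Real.sqrt y) := by rw [Real.log_sqrt hy0.le]; ring
    have h4 : Real.log y ≤ 2 * Real.sqrt y := by linarith
    calc Real.log y ^ 2 ≤ (2 * Real.sqrt y) ^ 2 := pow_le_pow_left₀ hly.le h4 2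
      _ = 4 * y := by rw [mul_pow, Real.sq_sqrt hy0.le]; norm_num
      _ ≤ 4 * x := by linarith
  have hratio : x / Real.log a ^ 2 ≤ 4 * (x / Real.log y ^ 2) := by
    rw [div_le_iff₀ (by positivity)]
    calc x = x / Real.log y ^ 2 * Real.log y ^ 2 := by field_simp
      _ ≤ x / Real.log y ^ 2 * (2 * Real.log a) ^ 2 := by gcongr
      _ = 4 * (x / Real.log y ^ 2) * Real.log a ^ 2 := by ring
  have hU0 : 0 ≤ x / Real.log y ^ 2 := by positivity
  have h3U : (3 : ℝ) ≤ 12 * (x / Real.log y ^ 2) := by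
    rw [mul_div_assoc', le_div_iff₀ (by positivity)]; linarith
  -- assembly
  rw [hmain]
  have hkey : |((roughIcc N X).card : ℝ) - (x / Real.log x - y / Real.log y)| ≤
      3 + (1 + 3 * C₀) * x / Real.log a ^ 2 := by
    have h := abs_le.mp hprimes
    rw [abs_le]
    constructor <;> linarith [h.1, h.2]
  calc _ ≤ 3 + (1 + 3 * C₀) * x / Real.log a ^ 2 := hkey
    _ = 3 + (1 + 3 * C₀) * (x / Real.log a ^ 2) := by ring
    _ ≤ 12 * (x / Real.log y ^ 2) + (1 + 3 * C₀) * (4 * (x / Real.log y ^ 2)) := by gcongr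
    _ = (16 + 12 * C₀) * x / Real.log y ^ 2 := by ring

/-! ### The induction and the final statements -/

/-- **`Φ(x, y) = (x ω(u) − y)/log y + O_k(x/log² y)` for `y ≤ x ≤ y^k`**: for every `k ≥ 2` there
is `C ≥ 0` with `|Φ(x, y) − (x ω(log x/log y) − y)/log y| ≤ C x/log² y` whenever `2 ≤ y ≤ x` and
`log x ≤ k log y` (induction on `k`: `abs_card_roughIcc_sub_main_base`,
`abs_card_roughIcc_sub_main_step`; Harman, Appendix A.2). [cite: Lichtman2025LinearSieve, Lemma 6.1] -/
theorem exists_abs_card_roughIcc_sub_main_le (k : ℕ) (hk : 2 ≤ k) :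
    ∃ C : ℝ, 0 ≤ C ∧ ∀ x y : ℝ, 2 ≤ y → y ≤ x → Real.log x ≤ k * Real.log y →
      |((roughIcc ⌈y⌉₊ ⌊x⌋₊).card : ℝ) -
          (x * buchstabOmega (Real.log x / Real.log y) - y) / Real.log y| ≤
        C * x / Real.log y ^ 2 := by
  obtain ⟨C₀, hC₀, hE⟩ := Literature.NumberTheory.LFunctions.exists_abs_theta_sub_self_le_div_log_sq
  induction k, hk using Nat.le_induction with
  | base =>
    refine ⟨16 + 12 * C₀, by positivity, fun x y hy hyx hxy => ?_⟩
    exact abs_card_roughIcc_sub_main_base hC₀ hE hy hyx (by exact_mod_cast hxy)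
  | succ k hk ih =>
    obtain ⟨C, hC, hPk⟩ := ih
    refine ⟨C * (4 + 8 * C₀) + (12 * k + 172) * C₀ + 16, by positivity, fun x y hy hyx hxy => ?_⟩
    push_cast at hxy
    have hx0 : 0 ≤ x := by linarith
    have hly : 0 < Real.log y := Real.log_pos (by linarith)
    have hk0 : (0 : ℝ) ≤ k := Nat.cast_nonneg k
    have hCC : C ≤ C * (4 + 8 * C₀) + (12 * k + 172) * C₀ + 16 := by nlinarith
    by_cases h1 : Real.log x ≤ k * Real.log y
    · refine (hPk x y hy hyx h1).trans ?_
      rw [div_le_div_iff_of_pos_right (by positivity)]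
      exact mul_le_mul_of_nonneg_right hCC hx0
    push Not at h1
    rcases lt_or_ge y (Real.exp 2) with h2 | h2
    · refine (abs_card_roughIcc_sub_main_le_of_lt_exp_two hy hyx h2).trans ?_
      rw [div_le_div_iff_of_pos_right (by positivity)]
      refine mul_le_mul_of_nonneg_right ?_ hx0
      nlinarith
    · exact abs_card_roughIcc_sub_main_step hk hC hC₀ hE hPk h2 hyx h1 hxy

/-- The same with a real exponent: for every real `U` there is `C` with
`|Φ(x, y) − (x ω(u) − y)/log y| ≤ C x/log² y` for all `2 ≤ y ≤ x ≤ y^U`.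
[cite: Lichtman2025LinearSieve, Lemma 6.1] -/
theorem exists_abs_card_roughIcc_sub_main_le_of_rpow (U : ℝ) :
    ∃ C : ℝ, 0 ≤ C ∧ ∀ x y : ℝ, 2 ≤ y → y ≤ x → x ≤ y ^ U →
      |((roughIcc ⌈y⌉₊ ⌊x⌋₊).card : ℝ) -
          (x * buchstabOmega (Real.log x / Real.log y) - y) / Real.log y| ≤
        C * x / Real.log y ^ 2 := by
  obtain ⟨C, hC, h⟩ := exists_abs_card_roughIcc_sub_main_le (max 2 ⌈U⌉₊) (le_max_left _ _)
  refine ⟨C, hC, fun x y hy hyx hxU => h x y hy hyx ?_⟩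
  have hy0 : 0 < y := by linarith
  have hly : 0 < Real.log y := Real.log_pos (by linarith)
  have hU : U ≤ ((max 2 ⌈U⌉₊ : ℕ) : ℝ) := by
    calc U ≤ ⌈U⌉₊ := Nat.le_ceil U
      _ ≤ ((max 2 ⌈U⌉₊ : ℕ) : ℝ) := by exact_mod_cast le_max_right _ _
  calc Real.log x ≤ Real.log (y ^ U) := Real.log_le_log (by linarith) hxU
    _ = U * Real.log y := Real.log_rpow hy0 U
    _ ≤ _ := by gcongr

/-- **Lichtman's Lemma 6.1** (Wu [WuI]; Harman (1.4.14); Tenenbaum Ch. III.6, here for bounded `u`):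
for every real `U` there is `C` such that for all `2 ≤ y`, `y² ≤ x ≤ y^U`,
`|Φ(x, y) − ω(u) x/log y| ≤ C x/log² y`, `u = log x/log y`, where
`Φ(x, y) = #{1 ≤ n ≤ x : p ∣ n ⇒ p ≥ y}` and `ω` is Buchstab's function (for `u ≥ 2` the secondary
term `y/log y` is itself `≤ x/log² y`). [cite: Lichtman2025LinearSieve, Lemma 6.1] -/
theorem exists_abs_card_roughIcc_sub_buchstab_le (U : ℝ) :
    ∃ C : ℝ, 0 ≤ C ∧ ∀ x y : ℝ, 2 ≤ y → y ^ 2 ≤ x → x ≤ y ^ U →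
      |((roughIcc ⌈y⌉₊ ⌊x⌋₊).card : ℝ) -
          buchstabOmega (Real.log x / Real.log y) * x / Real.log y| ≤ C * x / Real.log y ^ 2 := by
  obtain ⟨C, hC, h⟩ := exists_abs_card_roughIcc_sub_main_le_of_rpow U
  refine ⟨C + 1, by positivity, fun x y hy hyx hxU => ?_⟩
  have hy0 : 0 < y := by linarith
  have hyx' : y ≤ x := le_trans (by nlinarith) hyx
  have hly : 0 < Real.log y := Real.log_pos (by linarith)
  have h1 := h x y hy hyx' hxU
  have h2 : y / Real.log y ≤ x / Real.log y ^ 2 := by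
    have hlogy : Real.log y ≤ y := by linarith [Real.log_le_sub_one_of_pos hy0]
    rw [div_le_div_iff₀ hly (by positivity)]
    calc y * Real.log y ^ 2 = (y * Real.log y) * Real.log y := by ring
      _ ≤ (y * y) * Real.log y := by gcongr
      _ ≤ x * Real.log y := by rw [← sq]; gcongr
  have h3 : (x * buchstabOmega (Real.log x / Real.log y) - y) / Real.log y =
      buchstabOmega (Real.log x / Real.log y) * x / Real.log y - y / Real.log y := by ring
  rw [h3] at h1
  have h4 := abs_sub_le (((roughIcc ⌈y⌉₊ ⌊x⌋₊).card : ℝ))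
    (buchstabOmega (Real.log x / Real.log y) * x / Real.log y - y / Real.log y)
    (buchstabOmega (Real.log x / Real.log y) * x / Real.log y)
  have h5 : |buchstabOmega (Real.log x / Real.log y) * x / Real.log y - y / Real.log y -
      buchstabOmega (Real.log x / Real.log y) * x / Real.log y| = y / Real.log y := by
    rw [sub_sub_cancel_left, abs_neg, abs_of_nonneg (by positivity)]
  rw [h5] at h4
  calc _ ≤ C * x / Real.log y ^ 2 + x / Real.log y ^ 2 := by linarith
    _ = (C + 1) * x / Real.log y ^ 2 := by ring

end Literature.NumberTheory.Sieve
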